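import Literature.MathematicalPhysics.QuantumFieldTheory.Balaban1983to89.B9Cor38WholeRel
import Literature.MathematicalPhysics.QuantumFieldTheory.Balaban1983to89.B9Thm310WholeDir

/-!
# `Balaban1983to89.B9Thm310WholeRel` — Theorem 3.10's (3.108) with the walk reading's support clause RELATIVE TO A BLOCK EQUIVALENCE
# (`WalkReading310.OKRel`): the localisation line of `B9Thm310Whole.term_W310OfOps_le` redone class-relative (multiplicity folded into
# the O(1) of (3.108)), the whole printed leaf `B9.Thm310Printed` (generic convergence pin and over the direction letters) and the
# record-geometry face — the Theorem-3.10 twin of `B9Cor38WholeRel` ∕ `B9Cor38WholeRelFaces`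

T. Bałaban, *Propagators for lattice gauge theories in a background field*, Commun. Math. Phys. **99** (1985) 389–434
[`Balaban1985BackgroundPropagators`, "B9"], Thm 3.10 (3.105)–(3.108) pp. 414–416, p. 413, Cor. 3.8 (3.91)–(3.94) p. 410, Cor. 3.6 p. 408,
(3.35) p. 396, (3.39) ∕ (3.42) p. 397; [4] = T. Bałaban, *Propagators and renormalization transformations for lattice gauge theories. II*,
Commun. Math. Phys. **96** (1984) 223–250 [`Balaban1984PropagatorsII`], (2.51)–(2.52) p. 232, Lemma 2.1 (2.59)–(2.61) pp. 233–234.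

statement-level skeleton of published theorems with citation tags; proofs where landed; nothing here is a claim about the
Yang–Mills mass gap

WHY THIS FILE (cell `pub-ymgap`, Track A node N06 [B9]; node00-def-Y RULING (A) on WORD-W1, bus l.42897; seat `pub-ymgap-dag-n06-c` g16).  The
strict clause `B9Thm310Whole.WalkReading310.OK.off` of the rows-19 walk reading has the same one-fibre defect as `B9Cor38Whole.WalkReading.OK.off`
(no faithful evaluation inhabits it when several sites share a carrier block).  The repair is the same: `WalkReading310.OKRel rd blk Rel`
(vanishing only off the `Rel`-class of y′; strict = `Rel := Eq`), the bound (3.108) through `B9Cor38WholeRel.abs_apply_le_of_hasMajorant_rel` with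
O(1) = m·B₀ (★ `term_W310OfOps_le_okRel`), the whole printed leaf with O(1) := max(m, 1)·B₀ (`thm310Printed_of_parts_okRel`,
★ `thm310Printed_of_local3107₂_okRel`), the definite-exponent face and the record-geometry face (`thm310Printed_exp261_of_rowSum261₂_okRel`,
★ `thm310Printed_exp261_geo9Y₂_okRel`) — each VERBATIM its strict original (`B9Thm310Whole.thm310Printed_of_parts`,
`B9Thm310WholeDir.thm310Printed_of_local3107₂`, `B9RWSumsDefinitePinsPairMDirA.thm310Printed_exp261_{of_rowSum261₂,geo9Y₂}`) with
`hrd : (rd i).OKRel (𝔬 i).blk (Rel i)` and the class package `Rel, m, hRd₂, hmult`.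

HONEST SCOPE.  Kernel bookkeeping; Corollary 3.6's blocks, the (3.89)-type factor bounds, the letters' structure, the sizes, (2.61) where
displayed and the locality inputs are HYPOTHESES of printed shape; nothing of [B9] or [4] asserted; COUNT-NEUTRAL; N06 NOT discharged; one
finite lattice programme — nothing continuum, nothing about OS positivity or the mass gap.
-/

namespace Literature.MathematicalPhysics.QuantumFieldTheory.Balaban1983to89.B9Thm310WholeRel

open Literature.MathematicalPhysics.QuantumFieldTheory.Balaban1983to89
open Finset B6RandomWalk B6RandomWalkHom B9Thm37Sum B9Thm34Ext B9Thm37Glue B9Thm37Whole B9Cor38Whole B9Cor38WholeDir B9Thm310Whole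
open B9RowSum261Faces B9RowSum261DefiniteFaces B9Ineq349Whole B9RWSums343to347Whole B9PinMembersKLevelV1 B9GeoLemma21KLevelV1
open B9RWSums347DefiniteFaces B9RWSums346SecondDiff B9RWSums346SecondDiffGp B9Thm37WholeDir B9Thm310WholeDir B9Cor38WholeRel

noncomputable section

/-! ## §0 The relative reading clause of the rows-19 walk reading -/

section Schema

variable {g : B9.Geometry} {B : B9.Backgrounds} {X ι A : Type}

/-- **The reading clauses of Theorem 3.10's evaluation RELATIVE TO A BLOCK EQUIVALENCE `Rel`** (the repaired form of
`B9Thm310Whole.WalkReading310.OK`; (3.39) ∕ (3.42) p. 397, Thm 3.3 p. 399): supp J ⊂ Δ(y′) ⇒ `ev J` vanishes at the model points x with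
`¬ Rel (blk x) y′`; |ev J| ≦ |J|; |J| ≧ 0.  A hypothesis schema; declared into the structure's namespace for dot-notation.
[cite: Balaban1985BackgroundPropagators, (3.39) + (3.42) p.397] -/
structure _root_.Literature.MathematicalPhysics.QuantumFieldTheory.Balaban1983to89.B9Thm310Whole.WalkReading310.OKRel
    (rd : WalkReading310 g B X ι A) (blk : X → g.Site) (Rel : g.Site → g.Site → Prop) : Prop where
  off : ∀ (lam : g.Loc) (y' : g.Site), g.suppIn lam y' → ∀ x, ¬ Rel (blk x) y' → rd.ev lam x = 0
  bound : ∀ (lam : g.Loc) (x : X), |rd.ev lam x| ≤ g.supNorm lam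
  norm_nonneg : ∀ lam : g.Loc, 0 ≤ g.supNorm lam

/-- Strict ⇒ relative for every reflexive relation. [cite: Balaban1985BackgroundPropagators, (3.42) p.397, bookkeeping] -/
theorem _root_.Literature.MathematicalPhysics.QuantumFieldTheory.Balaban1983to89.B9Thm310Whole.WalkReading310.OK.okRel
    {rd : WalkReading310 g B X ι A} {blk : X → g.Site} (h : rd.OK blk) (Rel : g.Site → g.Site → Prop)
    (hrefl : ∀ a, Rel a a) : rd.OKRel blk Rel :=
  ⟨fun lam y' hs x hx => h.off lam y' hs x fun he => hx (he ▸ hrefl _), h.bound, h.norm_nonneg⟩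

/-- At `Rel := Eq` the relative clauses ARE the strict ones. [cite: Balaban1985BackgroundPropagators, (3.42) p.397, bookkeeping] -/
theorem okRel310_eq_iff (rd : WalkReading310 g B X ι A) (blk : X → g.Site) : rd.OKRel blk Eq ↔ rd.OK blk :=
  ⟨fun h => ⟨h.off, h.bound, h.norm_nonneg⟩, fun h => h.okRel Eq fun _ => rfl⟩

end Schema

/-! ## §1 One member: the bound (3.108) at `W310OfOps` under the relative reading clauses -/

section OneMember

variable {g : B9.Geometry} [Fintype g.Site] [DecidableEq g.Site] {B : B9.Backgrounds} {X Y ι A : Type}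

omit [Fintype g.Site] [DecidableEq g.Site] in
/-- A nonnegative pointwise bound on the block bounds the block sup (`Real.iSup_le`). [folklore] -/
private theorem blkSup_le₃ (blk : X → g.Site) {f : X → ℝ} {y : g.Site} {c : ℝ} (hc : 0 ≤ c)
    (h : ∀ x, blk x = y → f x ≤ c) : blkSup blk f y ≤ c :=
  Real.iSup_le (fun x => h x.1 x.2) hc

/-- ★ **THE BOUND (3.108) at one member and one configuration U, RELATIVE READING CLAUSES** (`B9Thm310Whole.term_W310OfOps_le` with
`hrd : rd.OKRel 𝔬.blk Rel`; p. 416: *"|(R₀(X₀)R_{α₁}(X₁)·⋯·R_{αₙ}(Xₙ)J)(x)| ≦ O(1)(L^jη)²O(M^{−1/2})^{|ω|}M^{−1/2|ω|}e^{−(1/2)δ₀d(ω,y,y′)}|J|"*):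
O(1) = m·B₀, O(M^{−1/2}) = (θ₀c₁(α) + 1)M^{−1/2}, ½δ₀′ with δ₀′ = 2(1 − α)δ₀ — the walk majorant of `B9Thm37Sum.cor38_walk_majorant`
(head `Local342G`, factors `Factors389`) evaluated on J through `B9Cor38WholeRel.abs_apply_le_of_hasMajorant_rel`, then `mul_tail_le_walkFactor`.
[cite: Balaban1985BackgroundPropagators, Thm 3.10 (3.108) p.416 + Cor. 3.8 (3.91)–(3.94) p.410 + p.413; Balaban1984PropagatorsII, Lemma 2.1 (2.61) p.234 + (2.51)–(2.52) p.232] -/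
theorem term_W310OfOps_le_okRel [Fintype ι] [Fintype A] (𝔬 : Ops310 g B X Y ι A) (rd : WalkReading310 g B X ι A)
    (Conv : B.Cfg → Prop) (R : ℝ) (H : Prop) (d : ℕ) (δ₀ α ρ B₀ N N' NF Cℓ θ₀ : ℝ) (κ : Sizes310) (U : B.Cfg)
    (Rel : g.Site → g.Site → Prop) [DecidableRel Rel] (m : ℕ)
    (hRd₂ : ∀ a b b' : g.Site, Rel b b' → g.dist a b = g.dist a b')
    (hmult : ∀ y' : g.Site, (Finset.univ.filter (fun y'' => Rel y'' y')).card ≤ m)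
    (hB₀ : 0 ≤ B₀) (hδ₀ : 0 ≤ δ₀) (hα : 0 ≤ α) (hα1 : α ≤ 1) (hθ₀ : 0 ≤ θ₀) (hM : 0 < g.M)
    (hs : StaticOK310 𝔬 ρ N N' NF Cℓ κ) (h261 : Ineq261 d (toB6 g R H) δ₀ α) (hrd : rd.OKRel 𝔬.blk Rel)
    (hl : Local342G 𝔬 R H B₀ δ₀ U) (hf : Factors389 𝔬 R H θ₀ δ₀ U) (w : ℕ × ι × (ℕ → A)) (lam : g.Loc) (y y' : g.Site)
    (hy : y ∈ 𝔬.S w.2.1) (hlam : g.suppIn lam y') :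
    (W310OfOps 𝔬 rd Conv).term U w lam y ≤
      g.len y ^ 2 * B9.walkFactor ((m : ℝ) * B₀) (θ₀ * B6.c1 d δ₀ α + 1) g.M (2 * ((1 - α) * δ₀))
        ((W310OfOps 𝔬 rd Conv).wlen w) ((W310OfOps 𝔬 rd Conv).wdist w y y') * g.supNorm lam := by
  obtain ⟨n, q, a⟩ := w
  have hαδ : 0 ≤ α * δ₀ := mul_nonneg hα hδ₀
  have h1αδ : 0 ≤ (1 - α) * δ₀ := mul_nonneg (by linarith) hδ₀
  have hc1 : 0 ≤ B6.c1 d δ₀ α := c1_nonneg d δ₀ α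
  have hm : (0 : ℝ) ≤ m := Nat.cast_nonneg m
  have hθM : 0 ≤ θ₀ * g.M⁻¹ := mul_nonneg hθ₀ (inv_nonneg.mpr hM.le)
  -- (3.91)–(3.92): the term operator has the majorant 1_{S_{□₀}}(a)B₀(L^jη)²(θ₀M⁻¹c₁)ⁿe^{−(1−α)δ₀d_ω(a,b)}
  have hmaj' := cor38_walk_majorant (R := R) (H := H) 𝔬.blk d δ₀ α (θ₀ * g.M⁻¹) B₀ (walkSets310 𝔬 q a)
    (walkOps310 𝔬 U q a) (minLen g.dist (walkSets310 𝔬 q a) n) n hB₀ hθM hs.dnn hαδ h1αδ h261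
    (by
      simp only [walkOps310, walkSets310, if_true]
      exact hasMajorant_sandwich_local (R := R) (H := H) 𝔬.blk (hl.e0 q) (𝔬.h q) (hs.hh q) (𝔬.S q) (hs.hS q))
    (fun k hk _ => by
      have hk0 : k ≠ 0 := by omega
      simp only [walkOps310, walkSets310, hk0, if_false]
      exact hf.fac (a k))
    (fun a' b' => LB_minLen g.dist n (walkSets310 𝔬 q a) a' b')
  have hmaj : HasMajorant (g := toB6 g R H) 𝔬.blk (lprod (walkOps310 𝔬 U q a) n)
      (fun (a' b' : g.Site) => (if a' ∈ 𝔬.S q then B₀ * g.len a' ^ 2 else 0) * (θ₀ * g.M⁻¹ * B6.c1 d δ₀ α) ^ n *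
        Real.exp (-((1 - α) * δ₀ * minLen g.dist (walkSets310 𝔬 q a) n a' b'))) := by
    refine hasMajorant_mono (g := toB6 g R H) 𝔬.blk hmaj' fun a' b' => le_of_eq ?_
    simp only [walkSets310, if_true]
  obtain ⟨hKnn, hsat⟩ := walkMaj_nonneg_sat (r := (1 - α) * δ₀) hB₀ (mul_nonneg hθM hc1) (𝔬.S q) (walkSets310 𝔬 q a) n
    Rel hRd₂ y'
  -- evaluate at the argument J, relative to `Rel`: at most m blocks in the class of y′
  have hpt : ∀ x, 𝔬.blk x = y → |lprod (walkOps310 𝔬 U q a) n (rd.ev lam) x| ≤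
      (m : ℝ) * (B₀ * g.len y ^ 2 * (θ₀ * g.M⁻¹ * B6.c1 d δ₀ α) ^ n *
        Real.exp (-((1 - α) * δ₀ * (minLen g.dist (walkSets310 𝔬 q a) n y y')))) * g.supNorm lam := by
    intro x hx
    have hb := abs_apply_le_of_hasMajorant_rel (R := R) (H := H) 𝔬.blk hmaj hKnn hsat (hmult y') (hrd.norm_nonneg lam)
      (hrd.bound lam) (hrd.off lam y' hlam) x
    rw [hx, if_pos hy] at hb
    exact hb
  -- (θ₀M⁻¹c₁)ⁿ ≦ (cM⁻¹)ⁿ = (cM^{−1/2})ⁿM^{−n/2}, c = θ₀c₁ + 1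
  have hθc : θ₀ * g.M⁻¹ * B6.c1 d δ₀ α ≤ (θ₀ * B6.c1 d δ₀ α + 1) * g.M⁻¹ := by
    have hMinv : 0 ≤ g.M⁻¹ := inv_nonneg.mpr hM.le
    calc θ₀ * g.M⁻¹ * B6.c1 d δ₀ α = (θ₀ * B6.c1 d δ₀ α) * g.M⁻¹ := by ring
      _ ≤ (θ₀ * B6.c1 d δ₀ α + 1) * g.M⁻¹ := mul_le_mul_of_nonneg_right (by linarith) hMinv
  have hfac := mul_tail_le_walkFactor (r := (1 - α) * δ₀) (dω := minLen g.dist (walkSets310 𝔬 q a) n y y') n hm hB₀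
    (sq_nonneg (g.len y)) (mul_nonneg hθM hc1) hM hθc
  have hrhs : 0 ≤ g.len y ^ 2 * B9.walkFactor ((m : ℝ) * B₀) (θ₀ * B6.c1 d δ₀ α + 1) g.M (2 * ((1 - α) * δ₀)) n
      (minLen g.dist (walkSets310 𝔬 q a) n y y') * g.supNorm lam :=
    mul_nonneg (mul_nonneg (sq_nonneg _) (walkFactor_nonneg (mul_nonneg hm hB₀)
      (by have h0 : 0 ≤ θ₀ * B6.c1 d δ₀ α := mul_nonneg hθ₀ hc1; linarith) hM _ _)) (hrd.norm_nonneg lam)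
  show blkSup 𝔬.blk (fun x => |lprod (walkOps310 𝔬 U q a) n (rd.ev lam) x|) y ≤
    g.len y ^ 2 * B9.walkFactor ((m : ℝ) * B₀) (θ₀ * B6.c1 d δ₀ α + 1) g.M (2 * ((1 - α) * δ₀)) n
      (minLen g.dist (walkSets310 𝔬 q a) n y y') * g.supNorm lam
  refine blkSup_le₃ 𝔬.blk hrhs fun x hx => (hpt x hx).trans ?_
  exact mul_le_mul_of_nonneg_right hfac (hrd.norm_nonneg lam)

omit [Fintype g.Site] [DecidableEq g.Site] in
/-- Arithmetic of «for M sufficiently large»: M ≧ 2N_Fθ₀c₁ gives N_F·θ₀M⁻¹·c₁ ≦ ½. [folklore] -/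
private theorem small_of_threshold₃ {NF θ₀ c M : ℝ} (hM : 0 < M) (hbig : 2 * NF * θ₀ * c ≤ M) :
    NF * (θ₀ * M⁻¹) * c ≤ 1 / 2 := by
  have h1 : NF * (θ₀ * M⁻¹) * c = (NF * θ₀ * c) / M := by
    rw [div_eq_mul_inv]
    ring
  rw [h1, div_le_iff₀ hM]
  linarith

end OneMember

/-! ## §2 The whole printed leaf under the relative reading clauses -/

section Family

variable {I : Type} {c35 : ℝ} {geo : I → B9.Geometry} {bg : I → B9.Backgrounds}
variable [∀ i, Fintype (geo i).Site] [∀ i, DecidableEq (geo i).Site]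
variable {X Y ι A Dir : I → Type} [∀ i, Fintype (X i)] [∀ i, DecidableEq (X i)] [∀ i, Fintype (Y i)]
  [∀ i, DecidableEq (Y i)] [∀ i, Fintype (ι i)] [∀ i, Fintype (A i)] [∀ i, Fintype (Dir i)]

omit [∀ i, Fintype (X i)] [∀ i, DecidableEq (X i)] [∀ i, Fintype (Y i)] [∀ i, DecidableEq (Y i)] [∀ i, Fintype (Dir i)] in
/-- **The leaf at `W310OfOps … Conv` from its two parts, for ANY pinned convergence predicate, RELATIVE READING CLAUSES**
(`B9Thm310Whole.thm310Printed_of_parts` with `hrd : ∀ i, (rd i).OKRel (𝔬 i).blk (Rel i)`): M₂ := max(M₁, M_L, M_c), a₀ := a₁∕O(1),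
δ₀′ := 2(1 − α)δ₀, O(1) := max(m, 1)·B₀, c := θ₀c₁(α) + 1 (the bound (3.108) by `term_W310OfOps_le_okRel`, the localisation by
`locDep_W310OfOps`).  Bookkeeping; nothing of print asserted. [cite: Balaban1985BackgroundPropagators, Thm 3.10 (3.107)–(3.108) pp.415–416 + Cor. 3.6 p.408] -/
theorem thm310Printed_of_parts_okRel (𝔬 : ∀ i, Ops310 (geo i) (bg i) (X i) (Y i) (ι i) (A i))
    (rd : ∀ i, WalkReading310 (geo i) (bg i) (X i) (ι i) (A i)) (Conv : ∀ i, (bg i).Cfg → Prop) (R : I → ℝ)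
    (H : I → Prop) (κ : I → Sizes310) (d : ℕ) (α ρ N N' NF Cℓ θ₀ B₀ δ₀ a₁ M₁ ML Mc : ℝ)
    (Rel : ∀ i, (geo i).Site → (geo i).Site → Prop) [∀ i, DecidableRel (Rel i)] (m : ℕ)
    (hRd₂ : ∀ i (a b b' : (geo i).Site), Rel i b b' → (geo i).dist a b = (geo i).dist a b')
    (hmult : ∀ i (y' : (geo i).Site), (Finset.univ.filter (fun y'' => Rel i y'' y')).card ≤ m)
    (hc : 0 < c35) (hα : 0 ≤ α) (hα1 : α < 1) (hθ₀ : 0 ≤ θ₀) (hB₀ : 0 < B₀) (hδ₀ : 0 < δ₀) (ha₁ : 0 < a₁)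
    (hM₁ : 0 < M₁) (hst : ∀ i, StaticOK310 (𝔬 i) ρ N N' NF Cℓ (κ i))
    (hrd : ∀ i, (rd i).OKRel (𝔬 i).blk (Rel i)) (hloc : ∀ i, Locality310 (𝔬 i) (rd i))
    (h261 : ∀ i, ML ≤ (geo i).M → Ineq261 d (toB6 (geo i) (R i) (H i)) δ₀ α)
    (hconv : ∀ i, Mc ≤ (geo i).M → ∀ α₀ : ℝ, 0 < α₀ → c35 * (geo i).M * α₀ ≤ a₁ →
      ∀ U : (bg i).Cfg, (bg i).Reg335 c35 α₀ U → Conv i U)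
    (h36 : ∀ i, M₁ ≤ (geo i).M → ∀ α₀ : ℝ, 0 < α₀ → c35 * (geo i).M * α₀ ≤ a₁ →
      ∀ U : (bg i).Cfg, (bg i).Reg335 c35 α₀ U →
        Local342G (𝔬 i) (R i) (H i) B₀ δ₀ U ∧ Factors389 (𝔬 i) (R i) (H i) θ₀ δ₀ U) :
    B9.Thm310Printed c35 geo bg (fun i => W310OfOps (𝔬 i) (rd i) (Conv i)) := by
  have hc1 : 0 ≤ B6.c1 d δ₀ α := c1_nonneg d δ₀ α
  have hcpos : 0 < θ₀ * B6.c1 d δ₀ α + 1 := by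
    have h0 : 0 ≤ θ₀ * B6.c1 d δ₀ α := mul_nonneg hθ₀ hc1
    linarith
  have hmax : 0 < max (m : ℝ) 1 * B₀ := mul_pos (lt_of_lt_of_le one_pos (le_max_right _ _)) hB₀
  refine ⟨max M₁ (max ML Mc), a₁ / c35, 2 * ((1 - α) * δ₀), max (m : ℝ) 1 * B₀, θ₀ * B6.c1 d δ₀ α + 1,
    lt_max_of_lt_left hM₁, div_pos ha₁ hc, by nlinarith, hmax, hcpos, ?_⟩
  intro i hM α₀ hα₀ hMa U hU
  have hM₁i : M₁ ≤ (geo i).M := le_trans (le_max_left _ _) hM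
  have hMLi : ML ≤ (geo i).M := le_trans (le_trans (le_max_left _ _) (le_max_right _ _)) hM
  have hMci : Mc ≤ (geo i).M := le_trans (le_trans (le_max_right _ _) (le_max_right _ _)) hM
  have hMpos : 0 < (geo i).M := lt_of_lt_of_le hM₁ hM₁i
  have ha : c35 * (geo i).M * α₀ ≤ a₁ := by
    have h1 : (geo i).M * α₀ * c35 ≤ a₁ := (le_div_iff₀ hc).mp hMa
    calc c35 * (geo i).M * α₀ = (geo i).M * α₀ * c35 := by ring
      _ ≤ a₁ := h1
  obtain ⟨hl, hf⟩ := h36 i hM₁i α₀ hα₀ ha U hU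
  refine ⟨hconv i hMci α₀ hα₀ ha U hU, fun w lam y y' hfirst _hlast hlam => ⟨?_, ?_⟩⟩
  · exact locDep_W310OfOps (𝔬 i) (rd i) (Conv i) (hloc i) U w
  · refine (term_W310OfOps_le_okRel (𝔬 i) (rd i) (Conv i) (R i) (H i) d δ₀ α ρ B₀ N N' NF Cℓ θ₀ (κ i) U (Rel i) m
      (hRd₂ i) (hmult i) hB₀.le hδ₀.le hα hα1.le hθ₀ hMpos (hst i) (h261 i hMLi) (hrd i) hl hf w lam y y' hfirst hlam).trans ?_
    refine mul_le_mul_of_nonneg_right (mul_le_mul_of_nonneg_left (walkFactor_le_walkFactor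
      (mul_le_mul_of_nonneg_right (le_max_left _ _) hB₀.le) hcpos.le hMpos _ _) (sq_nonneg _)) ((hrd i).norm_nonneg lam)

/-- ★ **(OVER THE DIRECTION LETTERS.) THEOREM 3.10 AS THE WHOLE PRINTED LEAF `B9.Thm310Printed`, RELATIVE READING CLAUSES**
(`B9Thm310WholeDir.thm310Printed_of_local3107₂` with `hrd : ∀ i, (rd i).OKRel (𝔬 i).blk (Rel i)`): at the sup-block pin
`W310OfOps (𝔬 i) (rd i) (Conv3107 (𝔬 i) (R i) (H i) C δ)`, C = `const37 d δ₀ α ρ B₀ N N' Cℓ K`, δ = (1 − 2α)δ₀, from `Local342G`,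
`Factors389`, `DirSupSq310`, `Identities310₂`, the static data, the Leibniz sizes, the relative readings, the locality inputs and (2.61)
at α for M ≧ M_L; M₂ := max(M₁, M_L, 2N_Fθ₀c₁(α)), a₀ := a₁ ∕ O(1), O(1) := max(m, 1)·B₀.  Nothing of print asserted; NOT a node
discharge. [cite: Balaban1985BackgroundPropagators, Thm 3.10 (3.105)–(3.108) pp.414–416 + Cor. 3.6 p.408 + (3.35) p.396; Balaban1984PropagatorsII, Lemma 2.1 (2.61) p.234 + Prop 2.2 p.234] -/
theorem thm310Printed_of_local3107₂_okRel (𝔬 : ∀ i, Ops310 (geo i) (bg i) (X i) (Y i) (ι i) (A i))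
    (𝔡 : ∀ i, DirOps310 (𝔬 i) (Dir i)) (𝔩 : ∀ i, DirLetters310 (𝔬 i) (Dir i))
    (rd : ∀ i, WalkReading310 (geo i) (bg i) (X i) (ι i) (A i)) (R : I → ℝ) (H : I → Prop) (κ : I → Sizes310)
    (d : ℕ) (α ρ N N' NF Cℓ K θ₀ B₀ δ₀ a₁ M₁ ML : ℝ)
    (Rel : ∀ i, (geo i).Site → (geo i).Site → Prop) [∀ i, DecidableRel (Rel i)] (m : ℕ)
    (hRd₂ : ∀ i (a b b' : (geo i).Site), Rel i b b' → (geo i).dist a b = (geo i).dist a b')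
    (hmult : ∀ i (y' : (geo i).Site), (Finset.univ.filter (fun y'' => Rel i y'' y')).card ≤ m)
    (hc : 0 < c35) (hα : 0 ≤ α) (hα2 : α ≤ 1 / 2) (hN : 0 ≤ N) (hN' : 0 ≤ N') (hNF : 0 ≤ NF) (hCℓ : 1 ≤ Cℓ)
    (hK : 0 ≤ K) (hθ₀ : 0 ≤ θ₀) (hB₀ : 0 < B₀) (hδ₀ : 0 < δ₀) (ha₁ : 0 < a₁) (hM₁ : 0 < M₁)
    (hst : ∀ i, StaticOK310 (𝔬 i) ρ N N' NF Cℓ (κ i)) (hκ : ∀ i, (κ i).Bounded K)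
    (hrd : ∀ i, (rd i).OKRel (𝔬 i).blk (Rel i)) (hloc : ∀ i, Locality310 (𝔬 i) (rd i))
    (h261 : ∀ i, ML ≤ (geo i).M → Ineq261 d (toB6 (geo i) (R i) (H i)) δ₀ α)
    (h36 : ∀ i, M₁ ≤ (geo i).M → ∀ α₀ : ℝ, 0 < α₀ → c35 * (geo i).M * α₀ ≤ a₁ →
      ∀ U : (bg i).Cfg, (bg i).Reg335 c35 α₀ U →
        Local342G (𝔬 i) (R i) (H i) B₀ δ₀ U ∧ Factors389 (𝔬 i) (R i) (H i) θ₀ δ₀ U ∧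
          DirSupSq310 (𝔬 i) (𝔡 i) (R i) (H i) U ∧ Identities310₂ (𝔬 i) (𝔡 i) (𝔩 i) (R i) (H i) U) :
    B9.Thm310Printed c35 geo bg
      (fun i => W310OfOps (𝔬 i) (rd i)
        (Conv3107 (𝔬 i) (R i) (H i) (const37 d δ₀ α ρ B₀ N N' Cℓ K) ((1 - 2 * α) * δ₀))) := by
  refine thm310Printed_of_parts_okRel 𝔬 rd _ R H κ d α ρ N N' NF Cℓ θ₀ B₀ δ₀ a₁ M₁ ML
    (max M₁ (max ML (2 * NF * θ₀ * B6.c1 d δ₀ α))) Rel m hRd₂ hmult hc hα (by linarith) hθ₀ hB₀ hδ₀ ha₁ hM₁ hst hrd hloc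
    h261 (fun i hM α₀ hα₀ ha U hU => ?_) (fun i hM α₀ hα₀ ha U hU => ?_)
  · have hM₁i : M₁ ≤ (geo i).M := le_trans (le_max_left _ _) hM
    have hMLi : ML ≤ (geo i).M := le_trans (le_trans (le_max_left _ _) (le_max_right _ _)) hM
    have hbig : 2 * NF * θ₀ * B6.c1 d δ₀ α ≤ (geo i).M := le_trans (le_trans (le_max_right _ _) (le_max_right _ _)) hM
    have hMpos : 0 < (geo i).M := lt_of_lt_of_le hM₁ hM₁i
    obtain ⟨hl, hf, hT, hi⟩ := h36 i hM₁i α₀ hα₀ ha U hU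
    have hq : NF * (θ₀ * (geo i).M⁻¹) * B6.c1 d δ₀ α ≤ 1 / 2 := small_of_threshold₃ hMpos hbig
    exact conv3107_of_local3107₂ (𝔬 i) (𝔡 i) (𝔩 i) (R i) (H i) d δ₀ α ρ B₀ N N' NF Cℓ K θ₀ (κ i) U hB₀.le hδ₀.le hα hα2 hN hN'
      hNF hCℓ hK hθ₀ hMpos (hst i) (hκ i) (h261 i hMLi) hq hl hf hT hi
  · obtain ⟨hl, hf, -, -⟩ := h36 i hM α₀ hα₀ ha U hU
    exact ⟨hl, hf⟩

/-- **(OVER THE DIRECTION LETTERS.) THEOREM 3.10 AT THE DEFINITE EXPONENT, (2.61) SUPPLIED BY `RowSum261`, RELATIVE READING CLAUSES**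
(`B9RWSumsDefinitePinsPairMDirA.thm310Printed_exp261_of_rowSum261₂` with `hrd : ∀ i, (rd i).OKRel (𝔬 i).blk (Rel i)`).
[cite: Balaban1985BackgroundPropagators, Thm 3.10 (3.107)–(3.108) pp.415–416 + (3.35) p.396; Balaban1984PropagatorsII, Lemma 2.1 (2.61) p.234] -/
theorem thm310Printed_exp261_of_rowSum261₂_okRel (𝔬 : ∀ i, Ops310 (geo i) (bg i) (X i) (Y i) (ι i) (A i))
    (𝔡 : ∀ i, DirOps310 (𝔬 i) (Dir i)) (𝔩 : ∀ i, DirLetters310 (𝔬 i) (Dir i))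
    (rd : ∀ i, WalkReading310 (geo i) (bg i) (X i) (ι i) (A i)) (R : I → ℝ) (H : I → Prop)
    (κ : I → Sizes310) (α ρ N N' NF Cℓ K θ₀ B₀ δ₀ a₁ M₁ : ℝ)
    (Rel : ∀ i, (geo i).Site → (geo i).Site → Prop) [∀ i, DecidableRel (Rel i)] (m : ℕ)
    (hRd₂ : ∀ i (a b b' : (geo i).Site), Rel i b b' → (geo i).dist a b = (geo i).dist a b')
    (hmult : ∀ i (y' : (geo i).Site), (Finset.univ.filter (fun y'' => Rel i y'' y')).card ≤ m)
    (hc : 0 < c35) (hα : 0 < α) (hα2 : α ≤ 1 / 2) (hN : 0 ≤ N) (hN' : 0 ≤ N') (hNF : 0 ≤ NF) (hCℓ : 1 ≤ Cℓ)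
    (hK : 0 ≤ K) (hθ₀ : 0 ≤ θ₀) (hB₀ : 0 < B₀) (hδ₀ : 0 < δ₀) (ha₁ : 0 < a₁) (hM₁ : 0 < M₁)
    (hst : ∀ i, StaticOK310 (𝔬 i) ρ N N' NF Cℓ (κ i)) (hκ : ∀ i, (κ i).Bounded K)
    (hrd : ∀ i, (rd i).OKRel (𝔬 i).blk (Rel i)) (hloc : ∀ i, Locality310 (𝔬 i) (rd i))
    (hrow : RowSum261 geo)
    (h36 : ∀ i, M₁ ≤ (geo i).M → ∀ α₀ : ℝ, 0 < α₀ → c35 * (geo i).M * α₀ ≤ a₁ →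
      ∀ U : (bg i).Cfg, (bg i).Reg335 c35 α₀ U →
        Local342G (𝔬 i) (R i) (H i) B₀ δ₀ U ∧ Factors389 (𝔬 i) (R i) (H i) θ₀ δ₀ U ∧
          DirSupSq310 (𝔬 i) (𝔡 i) (R i) (H i) U ∧ Identities310₂ (𝔬 i) (𝔡 i) (𝔩 i) (R i) (H i) U) :
    B9.Thm310Printed c35 geo bg
      (fun i => W310OfOps (𝔬 i) (rd i)
        (Conv3107 (𝔬 i) (R i) (H i) (const37 (exp261 geo δ₀ α) δ₀ α ρ B₀ N N' Cℓ K) ((1 - 2 * α) * δ₀))) := by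
  obtain ⟨ML, h261⟩ := ineq261_exp261_of_rowSum261 (geo := geo) R H (mul_pos hα hδ₀) hrow
  exact thm310Printed_of_local3107₂_okRel 𝔬 𝔡 𝔩 rd R H κ _ α ρ N N' NF Cℓ K θ₀ B₀ δ₀ a₁ M₁ ML Rel m hRd₂ hmult hc hα.le hα2
    hN hN' hNF hCℓ hK hθ₀ hB₀ hδ₀ ha₁ hM₁ hst hκ hrd hloc h261 h36

end Family

/-! ## §3 Row 19 (t310) at the record geometry `geo9Y`, relative reading clauses, NO (2.61) binder -/

section FacesY

variable {d ℓ : ℕ} {hd : 1 ≤ d + 1} {hL : Odd (ℓ + 1) ∧ 1 < ℓ + 1} {b₀ b₁ : ℝ} {Mstar : ℕ}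
variable [∀ x : MemberY d ℓ hd hL b₀ b₁ Mstar, Fintype (geo9Y x).Site]
  [∀ x : MemberY d ℓ hd hL b₀ b₁ Mstar, DecidableEq (geo9Y x).Site]
variable {c35 : ℝ} {bg : MemberY d ℓ hd hL b₀ b₁ Mstar → B9.Backgrounds}
variable {X Y ι A Dir : MemberY d ℓ hd hL b₀ b₁ Mstar → Type} [∀ x, Fintype (X x)] [∀ x, DecidableEq (X x)]
  [∀ x, Fintype (Y x)] [∀ x, DecidableEq (Y x)] [∀ x, Fintype (ι x)] [∀ x, Fintype (A x)] [∀ x, Fintype (Dir x)]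

/-- ★ **(OVER THE DIRECTION LETTERS.) ROW 19 (t310) AT THE RECORD GEOMETRY WITH NO (2.61) BINDER, RELATIVE READING CLAUSES**
(`B9RWSumsDefinitePinsPairMDirA.thm310Printed_exp261_geo9Y₂` with `hrd : ∀ x, (rd x).OKRel (𝔬 x).blk (Rel x)`) — (2.61) from `rowSum261_geo9Y` BY NAME.
[cite: Balaban1985BackgroundPropagators, Thm 3.10 (3.107)–(3.108) pp.415–416 + (3.35) p.396; Balaban1984PropagatorsII, Lemma 2.1 (2.61) p.234] -/
theorem thm310Printed_exp261_geo9Y₂_okRel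
    (𝔬 : ∀ x : MemberY d ℓ hd hL b₀ b₁ Mstar, Ops310 (geo9Y x) (bg x) (X x) (Y x) (ι x) (A x))
    (𝔡 : ∀ x : MemberY d ℓ hd hL b₀ b₁ Mstar, DirOps310 (𝔬 x) (Dir x))
    (𝔩 : ∀ x : MemberY d ℓ hd hL b₀ b₁ Mstar, DirLetters310 (𝔬 x) (Dir x))
    (rd : ∀ x : MemberY d ℓ hd hL b₀ b₁ Mstar, WalkReading310 (geo9Y x) (bg x) (X x) (ι x) (A x))
    (R : MemberY d ℓ hd hL b₀ b₁ Mstar → ℝ) (H : MemberY d ℓ hd hL b₀ b₁ Mstar → Prop)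
    (κ : MemberY d ℓ hd hL b₀ b₁ Mstar → Sizes310) (α ρ N N' NF Cℓ K θ₀ B₀ δ₀ a₁ M₁ : ℝ)
    (Rel : ∀ x : MemberY d ℓ hd hL b₀ b₁ Mstar, (geo9Y x).Site → (geo9Y x).Site → Prop) [∀ x, DecidableRel (Rel x)]
    (m : ℕ)
    (hRd₂ : ∀ x (a b b' : (geo9Y x).Site), Rel x b b' → (geo9Y x).dist a b = (geo9Y x).dist a b')
    (hmult : ∀ x (y' : (geo9Y x).Site), (Finset.univ.filter (fun y'' => Rel x y'' y')).card ≤ m)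
    (hc : 0 < c35) (hα : 0 < α) (hα2 : α ≤ 1 / 2) (hN : 0 ≤ N) (hN' : 0 ≤ N') (hNF : 0 ≤ NF) (hCℓ : 1 ≤ Cℓ)
    (hK : 0 ≤ K) (hθ₀ : 0 ≤ θ₀) (hB₀ : 0 < B₀) (hδ₀ : 0 < δ₀) (ha₁ : 0 < a₁) (hM₁ : 0 < M₁)
    (hst : ∀ x, StaticOK310 (𝔬 x) ρ N N' NF Cℓ (κ x)) (hκ : ∀ x, (κ x).Bounded K)
    (hrd : ∀ x, (rd x).OKRel (𝔬 x).blk (Rel x)) (hloc : ∀ x, Locality310 (𝔬 x) (rd x))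
    (h36 : ∀ x, M₁ ≤ (geo9Y x).M → ∀ α₀ : ℝ, 0 < α₀ → c35 * (geo9Y x).M * α₀ ≤ a₁ →
      ∀ U : (bg x).Cfg, (bg x).Reg335 c35 α₀ U →
        Local342G (𝔬 x) (R x) (H x) B₀ δ₀ U ∧ Factors389 (𝔬 x) (R x) (H x) θ₀ δ₀ U ∧
          DirSupSq310 (𝔬 x) (𝔡 x) (R x) (H x) U ∧ Identities310₂ (𝔬 x) (𝔡 x) (𝔩 x) (R x) (H x) U) :
    B9.Thm310Printed c35 geo9Y bg
      (fun x => W310OfOps (𝔬 x) (rd x)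
        (Conv3107 (𝔬 x) (R x) (H x) (const37 (exp261 (@geo9Y d ℓ hd hL b₀ b₁ Mstar) δ₀ α) δ₀ α ρ B₀ N N' Cℓ K)
          ((1 - 2 * α) * δ₀))) :=
  thm310Printed_exp261_of_rowSum261₂_okRel 𝔬 𝔡 𝔩 rd R H κ α ρ N N' NF Cℓ K θ₀ B₀ δ₀ a₁ M₁ Rel m hRd₂ hmult hc hα hα2 hN hN'
    hNF hCℓ hK hθ₀ hB₀ hδ₀ ha₁ hM₁ hst hκ hrd hloc rowSum261_geo9Y h36

end FacesY

end

end Literature.MathematicalPhysics.QuantumFieldTheory.Balaban1983to89.B9Thm310WholeRel
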